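import Literature.AlgebraicGeometry.Frobenioids.ElementaryFrobenioid
import HarnessLib

/-!
# Frobenioids I, §1: isomorphisms of the elementary Frobenioid `F_Φ` (STEP-0 calibration fragment
# of the abc-iut cell)

Mochizuki, *The geometry of Frobenioids I: the general theory*, Kyushu J. Math. **62** (2008)
293–400, §1, Definition 1.1 (iii) and Remark 1.1.1, kurims text pp. 20–21, as used silently in the
proofs of Propositions 1.5, 1.6 (pp. 27–28) [cite: MochizukiFrdI2008, Prop. 1.5].

A morphism `(f, u, 1)` of `F_Φ` with `f` an isomorphism of `D` and `u` a unit is an isomorphism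
(inverse `(f⁻¹, (f⁻¹)^*(u⁻¹), 1)`); conversely an isomorphism of `F_Φ` has invertible projection,
Frobenius degree `1` and unit zero divisor. Separated from `ElementaryIsos.lean` so that the fiber
product files (Prop. 1.6) do not depend on the `F_{Φ^char}` chain. No statement of the paper is
strengthened.
-/

namespace Literature.AlgebraicGeometry.Frobenioids

open CategoryTheory Opposite

universe w v u

namespace ElemFrobenioid

variable {D : Type u} [Category.{v} D] {Φ : Dᵒᵖ ⥤ CommMonCat.{w}}

/-- In `N_{≥1}`, `m n = 1` forces `m = 1`. [cite: MochizukiFrdI2008, §0 p.10] -/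
private theorem pnat_eq_one_of_mul_eq_one_right {m n : ℕ+} (h : m * n = 1) : m = 1 :=
  PNat.eq (by
    rw [PNat.one_coe]
    exact Nat.eq_one_of_mul_eq_one_right (by rw [← PNat.mul_coe, h, PNat.one_coe]))

/-! ### Isomorphisms of `F_Φ` -/

/-- A morphism `(f, u, 1)` of `F_Φ` with `f` an isomorphism of `D` and `u` a unit is an
isomorphism (its inverse is `(f⁻¹, (f⁻¹)^*(u⁻¹), 1)`). [cite: MochizukiFrdI2008, Prop. 1.5] -/
theorem isIso_of_base_div_degFr {A B : ElemFrobenioid Φ} (φ : A ⟶ B) [IsIso (Base φ)]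
    (hu : IsUnit (Div φ)) (hn : degFr φ = 1) : IsIso φ := by
  obtain ⟨u, hu⟩ := hu
  refine ⟨⟨homMk (inv (Base φ)) (pull Φ (inv (Base φ)) ↑u⁻¹) 1, ?_, ?_⟩⟩
  · refine Hom.ext ?_ ?_ ?_
    · show Base φ ≫ inv (Base φ) = 𝟙 _
      exact IsIso.hom_inv_id _
    · show pull Φ (Base φ) (pull Φ (inv (Base φ)) ↑u⁻¹) * Div φ ^ ((1 : ℕ+) : ℕ) = 1
      rw [← pull_comp, IsIso.hom_inv_id, pull_id, PNat.one_coe, pow_one, ← hu, Units.inv_mul]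
    · show degFr φ * 1 = 1
      rw [hn, mul_one]
  · refine Hom.ext ?_ ?_ ?_
    · show inv (Base φ) ≫ Base φ = 𝟙 _
      exact IsIso.inv_hom_id _
    · show pull Φ (inv (Base φ)) (Div φ) * (pull Φ (inv (Base φ)) ↑u⁻¹) ^ (degFr φ : ℕ) = 1
      rw [hn, PNat.one_coe, pow_one, ← map_mul, ← hu, Units.mul_inv, map_one]
    · show 1 * degFr φ = 1
      rw [hn, mul_one]

/-- In particular `(f, u, 1)` with `f` an isomorphism and `u` a unit is an isomorphism.
[cite: MochizukiFrdI2008, Prop. 1.5] -/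
theorem isIso_homMk {A B : ElemFrobenioid Φ} (f : A.base ⟶ B.base) [IsIso f]
    {Z : Φ.obj (op A.base)} (hZ : IsUnit Z) : IsIso (homMk f Z 1) :=
  haveI : IsIso (Base (homMk f Z 1)) := ‹IsIso f›
  isIso_of_base_div_degFr _ hZ rfl

/-- An isomorphism of `F_Φ` projects to an isomorphism of `D`. [cite: MochizukiFrdI2008, Prop. 1.5] -/
theorem isIso_base_of_isIso {A B : ElemFrobenioid Φ} (φ : A ⟶ B) [IsIso φ] : IsIso (Base φ) :=
  (inferInstance : IsIso ((baseFunctor Φ).map φ))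

/-- An isomorphism of `F_Φ` has Frobenius degree `1`. [cite: MochizukiFrdI2008, Prop. 1.5] -/
theorem degFr_eq_one_of_isIso {A B : ElemFrobenioid Φ} (φ : A ⟶ B) [IsIso φ] : degFr φ = 1 :=
  pnat_eq_one_of_mul_eq_one_right (m := degFr φ) (n := degFr (inv φ))
    (by rw [← degFr_comp, IsIso.hom_inv_id, degFr_id])

/-- An isomorphism of `F_Φ` has unit zero divisor. [cite: MochizukiFrdI2008, Prop. 1.5] -/
theorem isUnit_div_of_isIso {A B : ElemFrobenioid Φ} (φ : A ⟶ B) [IsIso φ] : IsUnit (Div φ) := by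
  have h : pull Φ (Base φ) (Div (inv φ)) * Div φ ^ (degFr (inv φ) : ℕ) = 1 := by
    rw [← div_comp, IsIso.hom_inv_id, div_id]
  exact (isUnit_pow_iff (degFr (inv φ)).ne_zero).mp (IsUnit.of_mul_eq_one_right _ h)

end ElemFrobenioid

/-! ### Pull-back along an isomorphism of `D` (canonical home for these three facts) -/

section PullIso

variable {D : Type u} [Category.{v} D] (Φ : Dᵒᵖ ⥤ CommMonCat.{w})

/-- `(f⁻¹)^* ∘ f^* = id` for an isomorphism `f` of `D` (Def. 1.1 (ii): `Φ` is a functor).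
[cite: MochizukiFrdI2008, Def. 1.1(ii)] -/
@[simp] theorem pull_inv_pull {A B : D} (f : B ⟶ A) [IsIso f] (x : Φ.obj (op A)) :
    pull Φ (inv f) (pull Φ f x) = x := by
  rw [← pull_comp, IsIso.inv_hom_id, pull_id]

/-- `f^* ∘ (f⁻¹)^* = id` for an isomorphism `f` of `D`. [cite: MochizukiFrdI2008, Def. 1.1(ii)] -/
@[simp] theorem pull_pull_inv {A B : D} (f : B ⟶ A) [IsIso f] (y : Φ.obj (op B)) :
    pull Φ f (pull Φ (inv f) y) = y := by
  rw [← pull_comp, IsIso.hom_inv_id, pull_id]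

/-- `f^*` is injective for an isomorphism `f` of `D`. [cite: MochizukiFrdI2008, Def. 1.1(ii)] -/
theorem pull_injective_of_isIso {A B : D} (f : B ⟶ A) [IsIso f] : Function.Injective (pull Φ f) :=
  fun x y h => by rw [← pull_inv_pull Φ f x, h, pull_inv_pull]

end PullIso

end Literature.AlgebraicGeometry.Frobenioids
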